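import Summits.CriticalPhenomena.PercolationContinuityZ3.Theorems.PercNearOneGluingNoHeavyQuantLongTailTripleTopAlgW4
import HarnessLib

/-!
# QUANT lane R8, T-DEC: THE LONG-TAIL TRIPLE HUB BEYOND `3lo`, WHOLE RANGE `3lo ≤ K ≤ 4lo` — the third-branch and two-low torque-cost inequalities
# restated with `K ≤ 4lo` in place of `2K ≤ 7lo` (census-1 gen 33)

builds on p205010 (kernel theorem, internal audit signed; external expert review pending)

Support file (`--supports stmt-CriticalPhenomena-4575`), QUANT lane seat prim-quant-census-1 (gen 33); memo
`run/shared/lean/prim/quant/prim-quant-census-1/g33/WIDE3-G33.md` §2.  Theorems only, standard axioms, no sorries.  VERBATIM twins of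
`tripleWide_costTopOne` (`…QuantLongTailTripleWideCostTop`) and `tripleWide_costTopTwo` (`…QuantLongTailTripleWideCost`) with the shape hypothesis
`2K ≤ 7lo` replaced by `K ≤ 4lo`: the only uses of `2K ≤ 7lo` there were the four top-route certificates `ltTop_capTop_oneQ`, `ltTop_cost0_max`,
`ltTop_capTop_two`, `ltTop_cost2_max`, which `…QuantLongTailTripleTopAlgW4` extends to `K ≤ 4lo` (`ltTopW_*`, by the new certificates `ltTop4_*` for
`7lo ≤ 2K ≤ 8lo`).  The second branch's inequality `tripleWide_costMid` was already stated for `3lo ≤ K ≤ 4lo`.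
* **`tripleWide4_costTopOne`** — one low to the top: `0 ≤ (T₀ − xT)(u₀(T−3lo) + u₁(T−3lo−K) + u₂(T−3lo−2K)₊) − (3lo+3K−T)·xT·u₀` on `[τ, T₀]`.
* **`tripleWide4_costTopTwo`** — two lows to the top: `0 ≤ (T₀ − xT)(u₀(T−3lo) + u₁(T−3lo−K) + u₂(T−3lo−2K)) − (3lo+3K−T)·xT·(u₀+u₁)` on `[6lo+2K, T₀]`.
NUMERICS (memo §1, `g33/code/exp1_threebranch.py`, exact rationals): the three-branch rule and every inequality of its kernel decomposition have
0 failures on 18 shapes `3 ≤ K/lo ≤ 4.5` (the width-2 hub's single-route range ends at `4.73lo`; the certificates stop at `4lo`).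

HONEST STATUS.  Algebra only; `SiblingStep`, `GluedDominatedMass`, `SDECConvClosed`, `FarTreeRow` OPEN; RATE class (log\*) / honest sentence of
`run/shared/lean/prim/quant/README.md` unchanged.  [this work].  Nothing here is cited as a published result.  The gluing rows served
[cite: KozmaNitzan2024, Conjecture 3 (p. 15)]; product measure [cite: Grimmett1999, §1.3 p. 10].
-/

noncomputable section

namespace Summit.CriticalPhenomena.PercolationContinuityZ3.Theorems
namespace Quant
namespace LawDec

/-! ### Third branch: one low to the top (`K ≤ 4lo`) -/

/-- **the third branch's torque cost in the floor regime, one low** (`3lo ≤ K ≤ 4lo`, `θ = y`): exhausted middle-low credit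
`K·u₁ < (T−6lo)(u₀+u₁)`, exhausted second-branch capacity at `a = 1` (`2K·u₂ ≤ (K(g₁+g₂+g₃)−3lo)(u₀+u₂)`) and `T ≤ T₀` give
`0 ≤ (T₀ − xT)(u₀(T−3lo) + u₁(T−3lo−K) + u₂(T−3lo−2K)₊) − (3lo+3K−T)·xT·u₀`. [this work] -/
theorem tripleWide4_costTopOne (lo K g₁ g₂ g₃ x T : ℝ) (hlo0 : 0 < lo) (hK3R : 3 * lo ≤ K) (hK4 : K ≤ 4 * lo) (hg : lo ≤ K * g₁)
    (h12 : g₁ ≤ g₂) (h13 : g₁ ≤ g₃) (h21 : g₂ < 1) (h31 : g₃ < 1) (hx0 : 0 < x) (hxg : x * (lo + K) ≤ lo + K * g₁)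
    (hbr' : K * (g₁ * (1 - g₂) * (1 - g₃) + g₂ * (1 - g₁) * (1 - g₃) + g₃ * (1 - g₁) * (1 - g₂))
      < (T - 6 * lo) * ((1 - g₁) * (1 - g₂) * (1 - g₃) + (g₁ * (1 - g₂) * (1 - g₃) + g₂ * (1 - g₁) * (1 - g₃) + g₃ * (1 - g₁) * (1 - g₂))))
    (hcap2' : 2 * K * (g₁ * g₂ * (1 - g₃) + g₁ * g₃ * (1 - g₂) + g₂ * g₃ * (1 - g₁))
      ≤ (K * (g₁ + g₂ + g₃) - 3 * lo) * ((1 - g₁) * (1 - g₂) * (1 - g₃) + (g₁ * g₂ * (1 - g₃) + g₁ * g₃ * (1 - g₂) + g₂ * g₃ * (1 - g₁))))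
    (hTle : T ≤ 3 * lo + K * (g₁ + g₂ + g₃)) :
    0 ≤ (3 * lo + K * (g₁ + g₂ + g₃) - x * T)
        * ((1 - g₁) * (1 - g₂) * (1 - g₃) * (T - 3 * lo)
          + (g₁ * (1 - g₂) * (1 - g₃) + g₂ * (1 - g₁) * (1 - g₃) + g₃ * (1 - g₁) * (1 - g₂)) * (T - (3 * lo + K))
          + (g₁ * g₂ * (1 - g₃) + g₁ * g₃ * (1 - g₂) + g₂ * g₃ * (1 - g₁)) * max (T - (3 * lo + 2 * K)) 0)
      - (3 * lo + 3 * K - T) * (x * T) * ((1 - g₁) * (1 - g₂) * (1 - g₃)) := by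
  have hK0 : (0 : ℝ) < K := by linarith
  have hg10 : 0 < g₁ := by
    by_contra hc; push Not at hc
    have : K * g₁ ≤ 0 := mul_nonpos_of_nonneg_of_nonpos hK0.le hc
    linarith
  have hg11 : g₁ < 1 := lt_of_le_of_lt h12 h21
  have hg2 : 0 ≤ g₂ := le_trans hg10.le h12
  have hg3 : 0 ≤ g₃ := le_trans hg10.le h13
  have hg₂K : lo ≤ K * g₂ := le_trans hg (mul_le_mul_of_nonneg_left h12 hK0.le)
  have hg₃K : lo ≤ K * g₃ := le_trans hg (mul_le_mul_of_nonneg_left h13 hK0.le)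
  set u0 : ℝ := (1 - g₁) * (1 - g₂) * (1 - g₃) with hu0
  set u1 : ℝ := g₁ * (1 - g₂) * (1 - g₃) + g₂ * (1 - g₁) * (1 - g₃) + g₃ * (1 - g₁) * (1 - g₂) with hu1
  set u2 : ℝ := g₁ * g₂ * (1 - g₃) + g₁ * g₃ * (1 - g₂) + g₂ * g₃ * (1 - g₁) with hu2
  set u3 : ℝ := g₁ * g₂ * g₃ with hu3
  have hu0p : 0 < u0 := mul_pos (mul_pos (by linarith) (by linarith)) (by linarith)
  have hu1n : 0 ≤ u1 := by rw [hu1]; positivity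
  have hu2n : 0 ≤ u2 := by
    rw [hu2]
    have : 0 ≤ 1 - g₁ := by linarith
    have : 0 ≤ 1 - g₂ := by linarith
    have : 0 ≤ 1 - g₃ := by linarith
    positivity
  have hu3n : 0 ≤ u3 := by rw [hu3]; positivity
  set W : ℝ := u0 + u1 with hW
  have hWp : 0 < W := by linarith
  have hWne : W ≠ 0 := hWp.ne'
  set T₀ : ℝ := 3 * lo + K * (g₁ + g₂ + g₃) with hT₀
  have hT0p : 0 < T₀ := by
    have := mul_pos hK0 (by linarith : 0 < g₁ + g₂ + g₃); rw [hT₀]; linarith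
  have hT0top : T₀ < 3 * lo + 3 * K := by
    have := mul_lt_mul_of_pos_left (by linarith : g₁ + g₂ + g₃ < 3) hK0; rw [hT₀]; linarith
  have hB0 : (0 : ℝ) < lo + K := by linarith
  set D : ℝ := T - 6 * lo with hD
  have hDle : D ≤ K * (g₁ + g₂ + g₃) - 3 * lo := by rw [hD]; rw [hT₀] at hTle; linarith
  have htopAlg : K * u1 < (K * (g₁ + g₂ + g₃) - 3 * lo) * W := by
    have : D * W ≤ (K * (g₁ + g₂ + g₃) - 3 * lo) * W := mul_le_mul_of_nonneg_right hDle hWp.le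
    linarith
  have hx1 : x < 1 := by
    have : lo + K * g₁ < lo + K := by have := mul_lt_mul_of_pos_left hg11 hK0; linarith
    by_contra hc; push Not at hc
    have : 1 * (lo + K) ≤ x * (lo + K) := mul_le_mul_of_nonneg_right hc hB0.le
    linarith
  -- the one-low floor capacity of the top (`ltTop_capTop_oneQ`)
  have hxu3 : x * (u0 + u3) ≤ u3 := by
    have h1 := ltTopW_capTop_oneQ lo K g₁ g₂ g₃ hlo0 hK3R hK4 hg hg₂K hg₃K h12 h13 hg11.le h21.le h31.le
      (by have h := htopAlg.le; rw [hW, hu0, hu1] at h; exact h) (by have h := hcap2'; rw [hu0, hu2] at h; exact h)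
    rw [← hu0, ← hu3] at h1
    have h2 : x * (lo + K) * (u0 + u3) ≤ (lo + K * g₁) * (u0 + u3) :=
      mul_le_mul_of_nonneg_right hxg (add_nonneg hu0p.le hu3n)
    have h3 : (lo + K) * (x * (u0 + u3)) ≤ (lo + K) * u3 := by linarith
    exact le_of_mul_le_mul_left h3 hB0
  -- the two quadratics: `Ψ₀` (levers `3lo`, `3lo+K`) and `Ψ₊` (also the lever `3lo+2K`)
  set α : ℝ := -(T₀ * (3 * lo * u0 + (3 * lo + K) * u1)) with hα
  set β : ℝ := T₀ * (u0 + u1) + x * (3 * lo * u0 + (3 * lo + K) * u1) - (3 * lo + 3 * K) * x * u0 with hβ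
  set κ : ℝ := x * u1 with hκ
  have eΨ : ∀ S : ℝ, (T₀ - x * S) * (u0 * (S - 3 * lo) + u1 * (S - (3 * lo + K))) - (3 * lo + 3 * K - S) * (x * S) * u0
      = α + β * S - κ * S ^ 2 := by
    intro S; rw [hα, hβ, hκ]; ring
  set α' : ℝ := α - T₀ * u2 * (3 * lo + 2 * K) with hα'
  set β' : ℝ := β + T₀ * u2 + x * u2 * (3 * lo + 2 * K) with hβ'
  set κ' : ℝ := κ + x * u2 with hκ'
  have eΨ' : ∀ S : ℝ, (T₀ - x * S) * (u0 * (S - 3 * lo) + u1 * (S - (3 * lo + K)) + u2 * (S - (3 * lo + 2 * K)))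
      - (3 * lo + 3 * K - S) * (x * S) * u0 = α' + β' * S - κ' * S ^ 2 := by
    intro S; rw [hα', hβ', hκ', hα, hβ, hκ]; ring
  -- right end `T₀` (with the third lever): the torque identity and the floor capacity
  have hΨ'T0 : 0 ≤ (T₀ - x * T₀) * (u0 * (T₀ - 3 * lo) + u1 * (T₀ - (3 * lo + K)) + u2 * (T₀ - (3 * lo + 2 * K)))
      - (3 * lo + 3 * K - T₀) * (x * T₀) * u0 := by
    have torque : u0 * (T₀ - 3 * lo) + u1 * (T₀ - (3 * lo + K)) + u2 * (T₀ - (3 * lo + 2 * K)) = u3 * (3 * lo + 3 * K - T₀) := by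
      rw [hu0, hu1, hu2, hu3, hT₀]; ring
    rw [torque]
    have e : (T₀ - x * T₀) * (u3 * (3 * lo + 3 * K - T₀)) - (3 * lo + 3 * K - T₀) * (x * T₀) * u0
        = T₀ * (3 * lo + 3 * K - T₀) * (u3 - x * (u0 + u3)) := by ring
    rw [e]
    exact mul_nonneg (mul_nonneg hT0p.le (by linarith)) (by linarith)
  -- the gluing point `3lo+2K` (when `T₀ ≥ 3lo+2K`): nonnegative by hand
  have hΨmid : 3 * lo + 2 * K ≤ T₀ →
      0 ≤ (T₀ - x * (3 * lo + 2 * K)) * (u0 * (3 * lo + 2 * K - 3 * lo) + u1 * (3 * lo + 2 * K - (3 * lo + K)))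
        - (3 * lo + 3 * K - (3 * lo + 2 * K)) * (x * (3 * lo + 2 * K)) * u0 := by
    intro hmid
    have key0 : (lo + K * g₁) * u0 ≤ K * (1 - g₁) * (2 * u0 + u1) := by
      have e : K * (1 - g₁) * (2 * u0 + u1) - (lo + K * g₁) * u0 = (K - lo) * u0 + K * (1 - g₁) * ((1 - g₂) * (1 - g₃))
          + K * (1 - g₁) * ((g₂ - g₁) * (1 - g₃)) + K * (1 - g₁) * ((g₃ - g₁) * (1 - g₂)) := by
        rw [hu0, hu1]; ring
      have p1 : 0 ≤ (K - lo) * u0 := mul_nonneg (by linarith) hu0p.le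
      have p2 : 0 ≤ K * (1 - g₁) * ((1 - g₂) * (1 - g₃)) := mul_nonneg (mul_nonneg hK0.le (by linarith)) (mul_nonneg (by linarith) (by linarith))
      have p3 : 0 ≤ K * (1 - g₁) * ((g₂ - g₁) * (1 - g₃)) := mul_nonneg (mul_nonneg hK0.le (by linarith)) (mul_nonneg (by linarith) (by linarith))
      have p4 : 0 ≤ K * (1 - g₁) * ((g₃ - g₁) * (1 - g₂)) := mul_nonneg (mul_nonneg hK0.le (by linarith)) (mul_nonneg (by linarith) (by linarith))
      linarith
    have e : (T₀ - x * (3 * lo + 2 * K)) * (u0 * (3 * lo + 2 * K - 3 * lo) + u1 * (3 * lo + 2 * K - (3 * lo + K)))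
        - (3 * lo + 3 * K - (3 * lo + 2 * K)) * (x * (3 * lo + 2 * K)) * u0
        = K * ((T₀ - x * (3 * lo + 2 * K)) * (2 * u0 + u1) - x * (3 * lo + 2 * K) * u0) := by ring
    rw [e]
    refine mul_nonneg hK0.le ?_
    have hm0 : (0 : ℝ) ≤ 3 * lo + 2 * K := by linarith
    have h20 : 0 ≤ 2 * u0 + u1 := by linarith
    -- `(1−x)(2u0+u1) ≥ x·u0` after multiplying by `lo + K`
    have f1 : x * (lo + K) * u0 ≤ (lo + K * g₁) * u0 := mul_le_mul_of_nonneg_right hxg hu0p.le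
    have f2 : K * (1 - g₁) * (2 * u0 + u1) ≤ (1 - x) * (lo + K) * (2 * u0 + u1) := mul_le_mul_of_nonneg_right (by linarith) h20
    have f3 : 0 ≤ (lo + K) * ((1 - x) * (2 * u0 + u1) - x * u0) := by linarith [f1, f2, key0]
    have f4 : 0 ≤ (1 - x) * (2 * u0 + u1) - x * u0 := nonneg_of_mul_nonneg_right (by linarith) hB0
    have f5 : (1 - x) * (3 * lo + 2 * K) ≤ T₀ - x * (3 * lo + 2 * K) := by linarith
    have f6 : (1 - x) * (3 * lo + 2 * K) * (2 * u0 + u1) ≤ (T₀ - x * (3 * lo + 2 * K)) * (2 * u0 + u1) := mul_le_mul_of_nonneg_right f5 h20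
    have f7 : 0 ≤ (3 * lo + 2 * K) * ((1 - x) * (2 * u0 + u1) - x * u0) := mul_nonneg hm0 f4
    linarith
  -- left end `τ = 6lo + K·u1/W` (without the third lever): `ltTop_cost0_max`
  set τ : ℝ := 6 * lo + K * u1 / W with hτ
  have hτW : τ * W = 6 * lo * W + K * u1 := by rw [hτ, add_mul, div_mul_cancel₀ _ hWne]
  have hτT : τ ≤ T := by
    have hDW : D * W = T * W - 6 * lo * W := by rw [hD]; ring
    have : τ * W ≤ T * W := by rw [hτW]; linarith
    exact le_of_mul_le_mul_right this hWp
  have hτT0 : τ ≤ T₀ := le_trans hτT hTle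
  have hC0 := ltTopW_cost0_max lo K g₁ g₂ g₃ hlo0 hK3R hK4 hg h12 h13 hg11.le h21.le h31.le
  rw [← hu0, ← hu1, ← hW] at hC0
  have hΨτ : 0 ≤ (T₀ - x * τ) * (u0 * (τ - 3 * lo) + u1 * (τ - (3 * lo + K))) - (3 * lo + 3 * K - τ) * (x * τ) * u0 := by
    have e1 : u0 * (τ - 3 * lo) + u1 * (τ - (3 * lo + K)) = 3 * lo * W := by
      have : (u0 * (τ - 3 * lo) + u1 * (τ - (3 * lo + K))) * W = (3 * lo * W) * W := by
        have e : (u0 * (τ - 3 * lo) + u1 * (τ - (3 * lo + K))) * W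
            = (τ * W) * (u0 + u1) - (3 * lo * u0 + (3 * lo + K) * u1) * W := by ring
        rw [e, hτW, hW]; ring
      exact mul_right_cancel₀ hWne this
    have e2 : (3 * lo + 3 * K - τ) * W = (3 * K - 3 * lo) * u0 + (2 * K - 3 * lo) * u1 := by
      have e : (3 * lo + 3 * K - τ) * W = (3 * lo + 3 * K) * W - τ * W := by ring
      rw [e, hτW, hW]; ring
    rw [e1]
    have key : 0 ≤ ((T₀ - x * τ) * (3 * lo * W) - (3 * lo + 3 * K - τ) * (x * τ) * u0) * W := by
      have e : ((T₀ - x * τ) * (3 * lo * W) - (3 * lo + 3 * K - τ) * (x * τ) * u0) * W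
          = (T₀ - x * τ) * (3 * lo * W ^ 2) - (x * τ) * u0 * ((3 * lo + 3 * K - τ) * W) := by ring
      rw [e, e2]
      set br : ℝ := (3 * K - 3 * lo) * u0 + (2 * K - 3 * lo) * u1 with hbr
      have hbr0 : 0 ≤ br := by
        rw [hbr]; exact add_nonneg (mul_nonneg (by linarith) hu0p.le) (mul_nonneg (by linarith) hu1n)
      have hubr : 0 ≤ u0 * br := mul_nonneg hu0p.le hbr0
      have m1 : T₀ - x * T₀ ≤ T₀ - x * τ := by have := mul_le_mul_of_nonneg_left hτT0 hx0.le; linarith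
      have m5 : (T₀ - x * T₀) * (3 * lo * W ^ 2) ≤ (T₀ - x * τ) * (3 * lo * W ^ 2) := mul_le_mul_of_nonneg_right m1 (by positivity)
      have m2 : (x * τ) * u0 * br ≤ (x * T₀) * u0 * br :=
        mul_le_mul_of_nonneg_right (mul_le_mul_of_nonneg_right (mul_le_mul_of_nonneg_left hτT0 hx0.le) hu0p.le) hbr0
      -- `x·u0·br ≤ 3lo(1−x)W²` from `ltTop_cost0_max` and the floor bound
      have f1 : x * (lo + K) * (u0 * br) ≤ (lo + K * g₁) * (u0 * br) := mul_le_mul_of_nonneg_right hxg hubr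
      have f2 : (lo + K * g₁) * (u0 * br) ≤ 3 * lo * K * (1 - g₁) * W ^ 2 := by rw [hbr]; exact hC0
      have f3 : 3 * lo * K * (1 - g₁) * W ^ 2 ≤ 3 * lo * ((1 - x) * (lo + K)) * W ^ 2 := by
        have h3 : K * (1 - g₁) ≤ (1 - x) * (lo + K) := by linarith
        have h4 : 0 ≤ 3 * lo * W ^ 2 := by positivity
        have h5 := mul_le_mul_of_nonneg_left h3 h4
        have e1 : 3 * lo * K * (1 - g₁) * W ^ 2 = 3 * lo * W ^ 2 * (K * (1 - g₁)) := by ring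
        have e2 : 3 * lo * ((1 - x) * (lo + K)) * W ^ 2 = 3 * lo * W ^ 2 * ((1 - x) * (lo + K)) := by ring
        rw [e1, e2]; exact h5
      have f4 : 0 ≤ (lo + K) * (3 * lo * (1 - x) * W ^ 2 - x * u0 * br) := by
        have e : (lo + K) * (3 * lo * (1 - x) * W ^ 2 - x * u0 * br)
            = 3 * lo * ((1 - x) * (lo + K)) * W ^ 2 - x * (lo + K) * (u0 * br) := by ring
        rw [e]; linarith [f1, f2, f3]
      have f5 : 0 ≤ 3 * lo * (1 - x) * W ^ 2 - x * u0 * br := nonneg_of_mul_nonneg_right f4 hB0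
      have m3 : (T₀ - x * T₀) * (3 * lo * W ^ 2) - (x * T₀) * u0 * br = T₀ * (3 * lo * (1 - x) * W ^ 2 - x * u0 * br) := by ring
      have m4 : 0 ≤ T₀ * (3 * lo * (1 - x) * W ^ 2 - x * u0 * br) := mul_nonneg hT0p.le f5
      linarith
    exact nonneg_of_mul_nonneg_left key hWp
  have hκ0 : 0 ≤ κ := by rw [hκ]; exact mul_nonneg hx0.le hu1n
  have hκ'0 : 0 ≤ κ' := by rw [hκ']; exact add_nonneg hκ0 (mul_nonneg hx0.le hu2n)
  by_cases hT2K : T ≤ 3 * lo + 2 * K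
  · -- no third lever: `Ψ₀` on `[τ, min(T₀, 3lo+2K)]`
    have hmax : max (T - (3 * lo + 2 * K)) 0 = 0 := max_eq_right (sub_nonpos.2 hT2K)
    rw [hmax, mul_zero, add_zero]
    set S₁ : ℝ := min T₀ (3 * lo + 2 * K) with hS₁
    have hTS₁ : T ≤ S₁ := le_min hTle hT2K
    have hΨS₁ : 0 ≤ (T₀ - x * S₁) * (u0 * (S₁ - 3 * lo) + u1 * (S₁ - (3 * lo + K))) - (3 * lo + 3 * K - S₁) * (x * S₁) * u0 := by
      rcases le_total T₀ (3 * lo + 2 * K) with hle | hle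
      · have eS : S₁ = T₀ := min_eq_left hle
        rw [eS]
        have e : (T₀ - x * T₀) * (u0 * (T₀ - 3 * lo) + u1 * (T₀ - (3 * lo + K))) - (3 * lo + 3 * K - T₀) * (x * T₀) * u0
            = ((T₀ - x * T₀) * (u0 * (T₀ - 3 * lo) + u1 * (T₀ - (3 * lo + K)) + u2 * (T₀ - (3 * lo + 2 * K)))
                - (3 * lo + 3 * K - T₀) * (x * T₀) * u0) + (T₀ - x * T₀) * u2 * (3 * lo + 2 * K - T₀) := by ring
        rw [e]
        have hx1' : 0 ≤ T₀ - x * T₀ := by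
          have := mul_le_mul_of_nonneg_right hx1.le hT0p.le; linarith
        have t2 : 0 ≤ (T₀ - x * T₀) * u2 * (3 * lo + 2 * K - T₀) := mul_nonneg (mul_nonneg hx1' hu2n) (by linarith)
        linarith
      · have eS : S₁ = 3 * lo + 2 * K := min_eq_right hle
        rw [eS]; exact hΨmid hle
    have h1 : 0 ≤ α + β * τ - κ * τ ^ 2 := by rw [← eΨ τ]; exact hΨτ
    have h2 : 0 ≤ α + β * S₁ - κ * S₁ ^ 2 := by rw [← eΨ S₁]; exact hΨS₁
    have hquad := quad_concave_between hκ0 h1 h2 hτT hTS₁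
    rw [eΨ T]; exact hquad
  · -- third lever charged: `Ψ₊` on `[3lo+2K, T₀]`
    push Not at hT2K
    have hmax : max (T - (3 * lo + 2 * K)) 0 = T - (3 * lo + 2 * K) := max_eq_left (sub_nonneg.2 hT2K.le)
    rw [hmax]
    have hmid : 3 * lo + 2 * K ≤ T₀ := le_trans hT2K.le hTle
    have h1 : 0 ≤ α' + β' * (3 * lo + 2 * K) - κ' * (3 * lo + 2 * K) ^ 2 := by
      rw [← eΨ' (3 * lo + 2 * K)]
      have e : (T₀ - x * (3 * lo + 2 * K)) * (u0 * (3 * lo + 2 * K - 3 * lo) + u1 * (3 * lo + 2 * K - (3 * lo + K))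
            + u2 * (3 * lo + 2 * K - (3 * lo + 2 * K))) - (3 * lo + 3 * K - (3 * lo + 2 * K)) * (x * (3 * lo + 2 * K)) * u0
          = (T₀ - x * (3 * lo + 2 * K)) * (u0 * (3 * lo + 2 * K - 3 * lo) + u1 * (3 * lo + 2 * K - (3 * lo + K)))
            - (3 * lo + 3 * K - (3 * lo + 2 * K)) * (x * (3 * lo + 2 * K)) * u0 := by ring
      rw [e]; exact hΨmid hmid
    have h2 : 0 ≤ α' + β' * T₀ - κ' * T₀ ^ 2 := by rw [← eΨ' T₀]; exact hΨ'T0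
    have hquad := quad_concave_between hκ'0 h1 h2 hT2K.le hTle
    rw [eΨ' T]; exact hquad

/-- **the top route's torque cost in the floor regime, two lows** (`3lo ≤ K ≤ 4lo`, `θ = y`, `6lo+2K ≤ T ≤ T₀`):
`0 ≤ (T₀ − xT)(u₀(T−3lo) + u₁(T−3lo−K) + u₂(T−3lo−2K)) − (3lo+3K−T)·xT·(u₀+u₁)`. [this work] -/
theorem tripleWide4_costTopTwo (lo K g₁ g₂ g₃ x T : ℝ) (hlo0 : 0 < lo) (hK3R : 3 * lo ≤ K) (hK4 : K ≤ 4 * lo) (hg : lo ≤ K * g₁)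
    (h12 : g₁ ≤ g₂) (h13 : g₁ ≤ g₃) (h21 : g₂ < 1) (h31 : g₃ < 1) (hx0 : 0 < x) (hxg : x * (lo + K) ≤ lo + K * g₁)
    (hT6 : 6 * lo + 2 * K ≤ T) (hTle : T ≤ 3 * lo + K * (g₁ + g₂ + g₃)) :
    0 ≤ (3 * lo + K * (g₁ + g₂ + g₃) - x * T)
        * ((1 - g₁) * (1 - g₂) * (1 - g₃) * (T - 3 * lo)
          + (g₁ * (1 - g₂) * (1 - g₃) + g₂ * (1 - g₁) * (1 - g₃) + g₃ * (1 - g₁) * (1 - g₂)) * (T - (3 * lo + K))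
          + (g₁ * g₂ * (1 - g₃) + g₁ * g₃ * (1 - g₂) + g₂ * g₃ * (1 - g₁)) * (T - (3 * lo + 2 * K)))
      - (3 * lo + 3 * K - T) * (x * T)
        * ((1 - g₁) * (1 - g₂) * (1 - g₃) + (g₁ * (1 - g₂) * (1 - g₃) + g₂ * (1 - g₁) * (1 - g₃) + g₃ * (1 - g₁) * (1 - g₂))) := by
  have hK0 : (0 : ℝ) < K := by linarith
  have hg10 : 0 < g₁ := by
    by_contra hc; push Not at hc
    have : K * g₁ ≤ 0 := mul_nonpos_of_nonneg_of_nonpos hK0.le hc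
    linarith
  have hg11 : g₁ < 1 := lt_of_le_of_lt h12 h21
  have hg2 : 0 ≤ g₂ := le_trans hg10.le h12
  have hg3 : 0 ≤ g₃ := le_trans hg10.le h13
  have hg₂K : lo ≤ K * g₂ := le_trans hg (mul_le_mul_of_nonneg_left h12 hK0.le)
  have hg₃K : lo ≤ K * g₃ := le_trans hg (mul_le_mul_of_nonneg_left h13 hK0.le)
  set u0 : ℝ := (1 - g₁) * (1 - g₂) * (1 - g₃) with hu0
  set u1 : ℝ := g₁ * (1 - g₂) * (1 - g₃) + g₂ * (1 - g₁) * (1 - g₃) + g₃ * (1 - g₁) * (1 - g₂) with hu1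
  set u2 : ℝ := g₁ * g₂ * (1 - g₃) + g₁ * g₃ * (1 - g₂) + g₂ * g₃ * (1 - g₁) with hu2
  set u3 : ℝ := g₁ * g₂ * g₃ with hu3
  have hu0p : 0 < u0 := mul_pos (mul_pos (by linarith) (by linarith)) (by linarith)
  have hu1n : 0 ≤ u1 := by rw [hu1]; positivity
  have hu2n : 0 ≤ u2 := by
    rw [hu2]
    have : 0 ≤ 1 - g₁ := by linarith
    have : 0 ≤ 1 - g₂ := by linarith
    have : 0 ≤ 1 - g₃ := by linarith
    positivity
  have hu3n : 0 ≤ u3 := by rw [hu3]; positivity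
  set W : ℝ := u0 + u1 with hW
  have hWp : 0 < W := by linarith
  set T₀ : ℝ := 3 * lo + K * (g₁ + g₂ + g₃) with hT₀
  have hT0p : 0 < T₀ := by
    have := mul_pos hK0 (by linarith : 0 < g₁ + g₂ + g₃); rw [hT₀]; linarith
  have hT0top : T₀ < 3 * lo + 3 * K := by
    have := mul_lt_mul_of_pos_left (by linarith : g₁ + g₂ + g₃ < 3) hK0; rw [hT₀]; linarith
  have hB0 : (0 : ℝ) < lo + K := by linarith
  have hL2 : 2 * K ≤ K * (g₁ + g₂ + g₃) - 3 * lo := by rw [hT₀] at hTle; linarith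
  have hx1 : x < 1 := by
    have : lo + K * g₁ < lo + K := by have := mul_lt_mul_of_pos_left hg11 hK0; linarith
    by_contra hc; push Not at hc
    have : 1 * (lo + K) ≤ x * (lo + K) := mul_le_mul_of_nonneg_right hc hB0.le
    linarith
  -- the two-low floor capacity of the top (`ltTop_capTop_two`)
  have hxu3 : x * (W + u3) ≤ u3 := by
    have h1 := ltTopW_capTop_two lo K g₁ g₂ g₃ hlo0 hK3R hK4 hg hg₂K hg₃K h12 h13 hg11.le h21.le h31.le hL2
    rw [← hu0, ← hu1, ← hu3, ← hW] at h1
    have h2 : x * (lo + K) * (W + u3) ≤ (lo + K * g₁) * (W + u3) :=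
      mul_le_mul_of_nonneg_right hxg (add_nonneg hWp.le hu3n)
    have h3 : (lo + K) * (x * (W + u3)) ≤ (lo + K) * u3 := by linarith
    exact le_of_mul_le_mul_left h3 hB0
  -- the quadratic `Ψ₂(S) = (T₀ − xS)(u0(S−3lo) + u1(S−3lo−K) + u2(S−3lo−2K)) − (3lo+3K−S)·xS·W`
  set α : ℝ := -(T₀ * (3 * lo * u0 + (3 * lo + K) * u1 + (3 * lo + 2 * K) * u2)) with hα
  set β : ℝ := T₀ * (u0 + u1 + u2) + x * (3 * lo * u0 + (3 * lo + K) * u1 + (3 * lo + 2 * K) * u2) - (3 * lo + 3 * K) * x * W with hβ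
  set κ : ℝ := x * u2 with hκ
  have eΨ : ∀ S : ℝ, (T₀ - x * S) * (u0 * (S - 3 * lo) + u1 * (S - (3 * lo + K)) + u2 * (S - (3 * lo + 2 * K)))
      - (3 * lo + 3 * K - S) * (x * S) * W = α + β * S - κ * S ^ 2 := by
    intro S; rw [hα, hβ, hκ, hW]; ring
  -- right end `T₀`: torque identity and the floor capacity
  have h2 : 0 ≤ α + β * T₀ - κ * T₀ ^ 2 := by
    rw [← eΨ T₀]
    have torque : u0 * (T₀ - 3 * lo) + u1 * (T₀ - (3 * lo + K)) + u2 * (T₀ - (3 * lo + 2 * K)) = u3 * (3 * lo + 3 * K - T₀) := by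
      rw [hu0, hu1, hu2, hu3, hT₀]; ring
    rw [torque]
    have e : (T₀ - x * T₀) * (u3 * (3 * lo + 3 * K - T₀)) - (3 * lo + 3 * K - T₀) * (x * T₀) * W
        = T₀ * (3 * lo + 3 * K - T₀) * (u3 - x * (W + u3)) := by ring
    rw [e]
    exact mul_nonneg (mul_nonneg hT0p.le (by linarith)) (by linarith)
  -- left end `6lo+2K`: `ltTop_cost2_max`
  have h1 : 0 ≤ α + β * (6 * lo + 2 * K) - κ * (6 * lo + 2 * K) ^ 2 := by
    rw [← eΨ (6 * lo + 2 * K)]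
    set B : ℝ := u0 * (3 * lo + 2 * K) + u1 * (3 * lo + K) + u2 * (3 * lo) with hB
    have hB0' : 0 ≤ B := by
      rw [hB]; exact add_nonneg (add_nonneg (mul_nonneg hu0p.le (by linarith)) (mul_nonneg hu1n (by linarith))) (mul_nonneg hu2n (by linarith))
    have e : (T₀ - x * (6 * lo + 2 * K)) * (u0 * (6 * lo + 2 * K - 3 * lo) + u1 * (6 * lo + 2 * K - (3 * lo + K)) + u2 * (6 * lo + 2 * K - (3 * lo + 2 * K)))
        - (3 * lo + 3 * K - (6 * lo + 2 * K)) * (x * (6 * lo + 2 * K)) * W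
        = (T₀ - x * (6 * lo + 2 * K)) * B - (K - 3 * lo) * (x * (6 * lo + 2 * K)) * W := by rw [hB]; ring
    rw [e]
    have hC2 := ltTopW_cost2_max lo K g₁ g₂ g₃ hlo0 hK3R hK4 hg hg₂K hg₃K h12 h13 hg11.le h21.le h31.le hL2
    rw [← hu0, ← hu1, ← hu2, ← hW, ← hT₀, ← hB] at hC2
    have hm0 : (0 : ℝ) ≤ 6 * lo + 2 * K := by linarith
    have f1 : x * (lo + K) * ((6 * lo + 2 * K) * W) ≤ (lo + K * g₁) * ((6 * lo + 2 * K) * W) :=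
      mul_le_mul_of_nonneg_right hxg (mul_nonneg hm0 hWp.le)
    have f2 : (K - 3 * lo) * (x * (lo + K) * ((6 * lo + 2 * K) * W)) ≤ (K - 3 * lo) * ((lo + K * g₁) * ((6 * lo + 2 * K) * W)) :=
      mul_le_mul_of_nonneg_left f1 (by linarith)
    have f3 : x * (lo + K) * (6 * lo + 2 * K) * B ≤ (lo + K * g₁) * (6 * lo + 2 * K) * B :=
      mul_le_mul_of_nonneg_right (mul_le_mul_of_nonneg_right hxg hm0) hB0'
    have f4 : 0 ≤ (lo + K) * ((T₀ - x * (6 * lo + 2 * K)) * B - (K - 3 * lo) * (x * (6 * lo + 2 * K)) * W) := by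
      have e : (lo + K) * ((T₀ - x * (6 * lo + 2 * K)) * B - (K - 3 * lo) * (x * (6 * lo + 2 * K)) * W)
          = (T₀ * (lo + K)) * B - x * (lo + K) * (6 * lo + 2 * K) * B - (K - 3 * lo) * (x * (lo + K) * ((6 * lo + 2 * K) * W)) := by ring
      rw [e]
      have e2 : (K - 3 * lo) * (lo + K * g₁) * (6 * lo + 2 * K) * W = (K - 3 * lo) * ((lo + K * g₁) * ((6 * lo + 2 * K) * W)) := by ring
      have e3 : (T₀ * (lo + K) - (lo + K * g₁) * (6 * lo + 2 * K)) * B = (T₀ * (lo + K)) * B - (lo + K * g₁) * (6 * lo + 2 * K) * B := by ring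
      rw [e2, e3] at hC2
      linarith [hC2, f2, f3]
    exact nonneg_of_mul_nonneg_right f4 hB0
  have hκ0 : 0 ≤ κ := by rw [hκ]; exact mul_nonneg hx0.le hu2n
  have hquad := quad_concave_between hκ0 h1 h2 hT6 hTle
  rw [eΨ T]; exact hquad

end LawDec
end Quant
end Summit.CriticalPhenomena.PercolationContinuityZ3.Theorems
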